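import Literature.NumberTheory.EllipticCurves.Rank1Residual.Typed.X5
import Literature.NumberTheory.EllipticCurves.Rank1Residual.Predicates
import Literature.NumberTheory.EllipticCurves.Selmer
import HarnessLib

/-!
# Class X5 at `p = 2` (cell `bsd-2adic`): the CLOSED RUNG LEAVES `NonCMAtTwo` (K4 / row B1) and
# `NonCMTwoConverse` (S3) — registered alternative closers (D-0061), statements only

HONEST FRAMING (cell `bsd-2adic`, run/shared/lean/pub/bsd-2adic/, HUMAN RULINGS D-0059/D-0061,
director-bsd 2026-08-25T18:38Z/18:45Z): this file DEFINES two closed `Prop`s (no section variables;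
`@NonCMAtTwo : Prop`, `@NonCMTwoConverse : Prop`) and proves ONE bookkeeping equivalence; it ASSERTS
NOTHING and books nothing. The two `Prop`s are the cell's rung targets, to be registered as RUNG
LEAVES of the summit sub-problem so that a ledger route (`Theses/ByReductionTypeAtTwo.lean`, planner
seat `bsd-2adic-plan`) can close them with `ledger route open … --closes-target <FQN>` (R5).
LOCATION: `Summits/BirchSwinnertonDyer/BirchSwinnertonDyer/Theorems/Rank1ResidualX5TwoDefs.lean`
(prover-only flat Theorems dir, namespace `Summit.BirchSwinnertonDyer.BirchSwinnertonDyer.Rank1Residual`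
exactly as the sibling leaf files `Rank1ResidualX1Defs.lean` / `Rank1ResidualX9Defs.lean`), because a
route file may import only `Mathlib/Literature/HarnessLib`, the summit Statement and
`Summits.<P>.<Sub>.Theorems.*` — NOT `Summits.BirchSwinnertonDyer.Rank1Residual.X5.*` (gate rule, checked
2026-08-25 with `ledger route check --native`). FQNs:
`Summit.BirchSwinnertonDyer.BirchSwinnertonDyer.Rank1Residual.NonCMAtTwo` (K4) and
`Summit.BirchSwinnertonDyer.BirchSwinnertonDyer.Rank1Residual.NonCMTwoConverse` (S3).

PARTITION (D-0054): X5@2 = the EXCLUDED-DOMAIN cell non-CM `p = 2` of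
`Summit.BirchSwinnertonDyer.Rank1Residual.bsdp_allCurves_of_not_corner_of_not_cornerF`
(`Partition/CornersAll.lean`; its domain hypothesis `hdom : W.HasCM ∨ (p ≠ 2 ∧ …)` excludes exactly
these pairs) = RESIDUAL-MAP B1·O1: 5 295 open book230 residue classes `N < 5·10⁵` (good-ordinary
611 + good-supersingular 763 + multiplicative 1 976 + additive 1 945; 5 275 of rank `0`, 20 of rank
`1`); CLASS = every non-CM `E/ℚ` of analytic rank `≤ 1` — types-the-object-of; closes none.

* `NonCMAtTwo` (FORMULA axis, rung K4 ⇒ row B1): for every non-CM `E/ℚ` of analytic rank `≤ 1`, in a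
  globally minimal model `W` (every `E/ℚ` has one, `hasGlobalMinimalModel_rat_holds`; every kernel
  theorem of `Rank1Residual` carries `[W.IsGloballyMinimal]` for the same reason), Miller's
  `BSD(E,2)` holds: `BSDp W 2` = (`rank E(ℚ) = r_an` ∧ `Ш(E/ℚ)[2^∞]` finite ∧
  `ord₂ #Ш_an = ord₂ #Ш[2^∞]`). Modulo Gross–Zagier–Kolyvagin this is LITERALLY the ∀-closure over
  non-CM `E` of the typed residual `Typed.X5.MissingInputAt W 2`
  (`nonCMAtTwo_iff_forall_missingInputAt`, proved below from the tree's
  `X5.bsdp_of_missingInputAt` / `missingPPartAt_of_bsdp`). CM curves at `2` are NOT in this leaf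
  (rank 0: row C8; rank 1: corner `CornerF`/O12).
* `NonCMTwoConverse` (RANK axis, rung S3): the `2`-adic rank-`0`/`1` `p`-converse for non-CM `E/ℚ`
  with good ordinary or multiplicative reduction at `2`:
  `corank_{ℤ₂} Sel_{2^∞}(E/ℚ) = r ⇒ ord_{s=1} L(E,s) = r` (`r ∈ {0,1}`), the input consumed by
  Smith 2025 Thm. 1.1 for "100 % of quadratic twists". PARTITION: none — RANK axis (S3); its
  formula twin (D-0056) is `NonCMAtTwo`.

References: [cite: Miller2011LMS, Def. 1.1] (the currency `BSDp`); [cite: Kato2004Asterisque,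
Thm. 17.4]; [cite: GreenbergLNM1716, Thm. 4.1, Prop. 5.13, Prop. 5.14]; [cite: Matsuno2008,
Thm. 5.1, Prop. 6.2]; [cite: arXiv250317619, Thm. 1.1].
-/

noncomputable section

open scoped Classical

open WeierstrassCurve Literature.NumberTheory.EllipticCurves
  Literature.NumberTheory.EllipticCurves.Rank1Residual
  Literature.NumberTheory.EllipticCurves.Rank1Residual.Typed

set_option linter.dupNamespace false
set_option autoImplicit false

namespace Summit.BirchSwinnertonDyer.BirchSwinnertonDyer.Rank1Residual

/-- **Rung leaf `NonCMAtTwo` (FORMULA axis, K4 ⇒ row B1·O1; OPEN, nothing asserted).** For every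
non-CM elliptic curve over `ℚ` of analytic rank `≤ 1`, in a globally minimal model `W`, Miller's
`BSD(E,2)` holds (`BSDp W 2`: `rank E(ℚ) = r_an`, `Ш[2^∞]` finite, `ord₂ #Ш_an = ord₂ #Ш[2^∞]`).
[cite: Miller2011LMS, Def. 1.1] -/
@[conjecture] def NonCMAtTwo : Prop :=
  ∀ (W : WeierstrassCurve ℚ) [W.IsElliptic] [W.IsGloballyMinimal],
    ¬ W.HasCM → W.analyticRank ≤ 1 → BSDp W 2

/-- **Rung leaf `NonCMTwoConverse` (RANK axis, S3; OPEN, nothing asserted).** For every non-CM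
elliptic curve over `ℚ` with good ordinary or multiplicative reduction at `2` (globally minimal
model `W`) and `r ≤ 1`: `corank_{ℤ₂} Sel_{2^∞}(E/ℚ) = r ⇒ ord_{s=1} L(E,s) = r`.
[cite: arXiv250317619, Thm. 1.1 (its p-converse input at p = 2)] -/
@[conjecture] def NonCMTwoConverse : Prop :=
  ∀ (W : WeierstrassCurve ℚ) [W.IsElliptic] [W.IsGloballyMinimal],
    ¬ W.HasCM → (GoodOrd W 2 ∨ Mult W 2) → ∀ r : ℕ, r ≤ 1 → W.selmerCorank 2 = r →
      W.analyticRank = r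

/-- Honesty check (bookkeeping, proved): modulo Gross–Zagier–Kolyvagin (`hGZK`, the tree's named
fact `rank_eq_analyticRank_of_analyticRank_le_one`, used as a hypothesis), `NonCMAtTwo` is literally
the ∀-closure over non-CM `E` of the typed residual `Typed.X5.MissingInputAt W 2` (row B1's Prop).
[cite: Miller2011LMS, §1 and Def. 1.1] -/
theorem nonCMAtTwo_iff_forall_missingInputAt
    (hGZK : rank_eq_analyticRank_of_analyticRank_le_one) :
    NonCMAtTwo ↔
      ∀ (W : WeierstrassCurve ℚ) [W.IsElliptic] [W.IsGloballyMinimal],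
        ¬ W.HasCM → W.analyticRank ≤ 1 → X5.MissingInputAt W 2 := by
  constructor
  · intro h W _ _ hcm hr
    haveI : Finite W.sha := (hGZK W hr).2
    exact missingPPartAt_of_bsdp W 2 (h W hcm hr)
  · intro h W _ _ hcm hr
    exact X5.bsdp_of_missingInputAt hGZK W 2 hr rfl (h W hcm hr)

end Summit.BirchSwinnertonDyer.BirchSwinnertonDyer.Rank1Residual

end
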